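import Summits.BirchSwinnertonDyer.BirchSwinnertonDyer.Theorems.AlignedTransportAtTwoMainConjectureOfRankZeroBSDAtTwoHalfDescentLayerIndexGrowthDual
import Summits.BirchSwinnertonDyer.BirchSwinnertonDyer.Theorems.AlignedTransportAtTwoMainConjectureOfRankZeroBSDAtTwoSelmerLayerDuality
import Literature.NumberTheory.EllipticCurves.IwasawaSelmerControlExactCountProofs
import Literature.NumberTheory.EllipticCurves.IwasawaSelmerProofs
import HarnessLib

/-!
# Route `AlignedTransportAtTwo`, crux C2 `MainConjectureOfRankZeroBSDAtTwo` (stmt-BirchSwinnertonDyer-22298):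
# THE GROWTH NUMBER AT FINITE LEVEL, I — the image of `γ^{pⁿ} − 1` on `Sel_{p^∞}(E/K_{n+1})` computes the growth number
# `g_n = #(ω_nX/ω_{n+1}X) = #((conj_γ^{pⁿ} − 1)·Sel_∞^{Γ_{n+1}})` up to the control kernel and cokernel; hence
# `0 < #((conj_{γ^{pⁿ}} − 1)·Sel_{p^∞}(E/K_{n+1})) · #ker g_{n+1} < p^{pⁿ(p−1)}` at ANY ONE layer ⟹ `μ(X(E/K_∞)) = 0`, in ANY rank

HONEST FRAMING (cell `bsd-f1-sign2`, WIDTH-5 attached prover seat `bsd-line-att-p5` gen 57 on line `birth` of the lead `bsd-line-att-p2`;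
`--supports` stmt-BirchSwinnertonDyer-22298, closes nothing; BSD is NOT proved by any of this; the crux C2, its verdict «blocked-on
`Rank1Residual.GreenbergMuConjectureIrreducible`» and every registered stub (P / T / Kμ / LimDoor / MuIneqʳ / PFμ⁺) are untouched). THEOREMS ONLY — no `def`,
no instance, no named fact, no `sorry`. Route-independent (any number field `K`, any prime `p`, any `ℤ_p`-extension, any Pontryagin-dual datum, any rank).
Successor (i) of gen 56 (`…HalfDescentLayerIndexGrowthDual`: the growth number `g_n` of EVERY f.g. torsion Iwasawa module `X(E/K_∞)` is the order of the IMAGE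
`(conj_γ^{pⁿ} − 1)·Sel_∞^{Γ_{n+1}}` inside the LIMIT Selmer group, `p^{pⁿ(p−1)μ} ∣ g_n`, and `0 < g_n < p^{pⁿ(p−1)}` at one layer ⟹ `μ = 0`, complete). Here that
image is brought DOWN TO FINITE LEVEL `K_{n+1}` through the control map `s_{n+1} : Sel_{p^∞}(E/K_{n+1}) → Sel_∞^{Γ_{n+1}}` of the tree (`IwasawaSelmerControlExactCountProofs`:
`sMap`, `CokerS = Sel_∞^{Γ_{n+1}}/s_{n+1}(Sel_{n+1})`, Greenberg's `KerG = ker g_{n+1} = A_{n+1}/Sel_{n+1} ↠ CokerS`).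

* §1 (two intertwined endomorphisms, any abelian groups): for `s : A → B`, `ψ_A ∈ End A`, `ψ_B ∈ End B` with `s ∘ ψ_A = ψ_B ∘ s`:
  ★ `natCard_range_dvd_mul_natCard_ker` **`#ψ_A(A) ∣ #ψ_B(B) · #ker s`**; ★★ `natCard_range_mul_dvd` **`#ψ_B(B) · #(ker s ⊓ ψ_A(A)) ∣ #ψ_A(A) · #coker s`** (`ψ_B` induces
  `B/s(A) ↠ ψ_B(B)/s(ψ_A(A))`); `natCard_range_pos_and_le`; plus four transport lemmas (co-restrictions, an isomorphism after `s`).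
* §2 (Selmer, `g = γ^{pⁿ}`, `I_{n+1} := (conj_g − 1)·Sel_{p^∞}(E/K_{n+1}) ⊆ H¹(K_{n+1}, E[p^∞])`, `I_∞ := (conj_γ^{pⁿ} − 1)·Sel_∞^{Γ_{n+1}}`, `#I_∞ = g_n`): `s_{n+1}` intertwines
  `conj_g − 1` downstairs with `conj_γ^{pⁿ} − 1` upstairs (restriction commutes with conjugation, tree `resOfLe_comp_conjH1_holds`; `Sel_∞^{Γ_{n+1}} = ker(φ^{p^{n+1}} − 1)`,
  gen 40's `exists_addEquiv_selmerInvariants_endInvariants`), whence ★★ `natCard_map_endInvariants_mul_dvd_and_dvd` / `natCard_growth_mul_dvd_and_dvd`: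
  **`g_n · #(ker h_{n+1} ⊓ I_{n+1}) ∣ #I_{n+1} · #coker s_{n+1}`** and **`#I_{n+1} ∣ g_n · #ker s_{n+1}`** — no hypothesis at all.
* §3 ★★★ `mu_eq_zero_of_natCard_map_selmerLayer_mul_cokerS_lt` / `…_mul_kerG_lt`: **`0 < #I_{n+1} · #coker s_{n+1} < p^{pⁿ(p−1)}`** (resp. with Greenberg's `#ker g_{n+1}`,
  which `#coker s_{n+1}` divides) at SOME `n` ⟹ **`μ(X(E/K_∞)) = 0`** for EVERY dual datum with `X` f.g. torsion — the first one-layer certificate of the lineage that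
  is stated on a FINITE-LEVEL group and is not vacuous in positive rank (only the image of `g − 1` must be finite, not `Sel_{p^∞}(E/K_{n+1})`);
  ★★ `pow_mul_dvd_natCard_map_selmerLayer_mul_cokerS` (`p^{pⁿ(p−1)μ}·#(ker h_{n+1} ⊓ I_{n+1}) ∣ #I_{n+1}·#coker s_{n+1}` at EVERY layer).
Sequel (`…GrowthFiniteTwo`, `p = 2`): `g` is an involution of `Sel_{2^∞}(E/K_{n+1})`, `I_{n+1}` sits between `2M` and `M` for the minus part `M = ker(1 + g)` = kernel of
the relative norm of `K_{n+1}/K_n`, and the seed composition. What is NOT claimed: nothing about any curve; no order computed; C2 untouched.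
Memo `Cruxes/MainConjectureOfRankZeroBSDAtTwo/GROWTH-FINITE-att-p5-g57.md`.

References: R. Greenberg, LNM 1716 (1999), §1 pp. 60–65, Thm. 1.10, Conj. 1.11, §3 Lemmas 3.1–3.3 and pp. 85–86 (the maps `s_n`, `h_n`, `g_n` and the snake
sequence), §4 Lemma 4.3 (p. 103) [GreenbergLNM1716]; B. Mazur, Invent. Math. 18 (1972) §6 [Mazur1972]; L. Washington, GTM 83, §13.3 Thm. 13.13, Lemma 13.18
[Washington1997]; J. Neukirch, A. Schmidt, K. Wingberg, *Cohomology of Number Fields*, I.§5 [NeukirchSchmidtWingberg2008].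
-/

set_option linter.dupNamespace false
set_option autoImplicit false

noncomputable section

open scoped Classical AddSubgroup Polynomial

universe u

namespace Summit.BirchSwinnertonDyer.BirchSwinnertonDyer.Theorems.AlignedTransportAtTwoHalfDescentLayerIndexGrowthFinite

open WeierstrassCurve Literature.NumberTheory.EllipticCurves Literature.NumberTheory.EllipticCurves.IwasawaDual
  Literature.NumberTheory.EllipticCurves.PontryaginCard
  Literature.NumberTheory.EllipticCurves.IwasawaAlgebra
  Summit.BirchSwinnertonDyer.Rank1Residual.X1.MuLambda
  Summit.BirchSwinnertonDyer.Rank1Residual.Iwasawa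
  Summit.BirchSwinnertonDyer.BirchSwinnertonDyer.Theorems.AlignedTransportAtTwoHalfDescentLayerIndexGrowth
  Summit.BirchSwinnertonDyer.BirchSwinnertonDyer.Theorems.AlignedTransportAtTwoHalfDescentLayerIndexGrowthDual
  Summit.BirchSwinnertonDyer.BirchSwinnertonDyer.Theorems.AlignedTransportAtTwoSelmerLayerDuality

/-! ## §1 Two intertwined endomorphisms: the image downstairs computes the image upstairs up to `ker s` and `coker s` -/

section Abstract

variable {A B : Type*} [AddCommGroup A] [AddCommGroup B] (s : A →+ B) (ψA : A →+ A) (ψB : B →+ B)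

/-- If `s ∘ ψ_A = ψ_B ∘ s` then `s(ψ_A(A)) ≤ ψ_B(B)`. [folklore] -/
theorem map_range_le_range (h : ∀ a, s (ψA a) = ψB (s a)) : (ψA.range).map s ≤ ψB.range := by
  rintro _ ⟨a, ⟨a₀, rfl⟩, rfl⟩
  exact ⟨s a₀, (h a₀).symm⟩

/-- `#ψ_A(A) = #s(ψ_A(A)) · #(ker s ⊓ ψ_A(A))` (first isomorphism theorem for `s|_{ψ_A(A)}`; `Nat.card`). [folklore] -/
theorem natCard_range_eq_natCard_map_mul :
    Nat.card ψA.range = Nat.card ↥((ψA.range).map s) * Nat.card ↥(s.ker ⊓ ψA.range) := by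
  set t : ↥ψA.range →+ B := s.comp ψA.range.subtype with ht
  have hrange : t.range = (ψA.range).map s := by rw [ht, AddMonoidHom.range_comp, AddSubgroup.range_subtype]
  have hker : Nat.card t.ker = Nat.card ↥(s.ker ⊓ ψA.range) := by
    have e : t.ker = (s.ker ⊓ ψA.range).addSubgroupOf ψA.range := by
      ext x
      rw [AddMonoidHom.mem_ker, AddSubgroup.mem_addSubgroupOf, AddSubgroup.mem_inf, AddMonoidHom.mem_ker, ht,
        AddMonoidHom.comp_apply, AddSubgroup.coe_subtype]
      exact ⟨fun hx ↦ ⟨hx, x.2⟩, fun hx ↦ hx.1⟩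
    rw [e]
    exact Nat.card_congr (AddSubgroup.addSubgroupOfEquivOfLe inf_le_right).toEquiv
  rw [AddSubgroup.card_eq_card_quotient_mul_card_addSubgroup t.ker, Nat.card_congr (QuotientAddGroup.quotientKerEquivRange t).toEquiv,
    hrange, hker]

/-- ★ **`#ψ_A(A) ∣ #ψ_B(B) · #ker s`** when `s ∘ ψ_A = ψ_B ∘ s` (`Nat.card`; `s(ψ_A A) ≤ ψ_B B`, `ker s|_{ψ_A A} ≤ ker s`). [folklore] -/
theorem natCard_range_dvd_mul_natCard_ker (h : ∀ a, s (ψA a) = ψB (s a)) :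
    Nat.card ψA.range ∣ Nat.card ψB.range * Nat.card s.ker := by
  rw [natCard_range_eq_natCard_map_mul s ψA]
  exact mul_dvd_mul (AddSubgroup.card_dvd_of_le (map_range_le_range s ψA ψB h)) (AddSubgroup.card_dvd_of_le inf_le_left)

/-- ★★ **`#ψ_B(B) · #(ker s ⊓ ψ_A(A)) ∣ #ψ_A(A) · #coker s`** when `s ∘ ψ_A = ψ_B ∘ s` (`Nat.card`, `coker s = B/s(A)`): `ψ_B` induces a surjection
`B/s(A) ↠ ψ_B(B)/s(ψ_A(A))`, and `#s(ψ_A(A)) · #(ker s ⊓ ψ_A(A)) = #ψ_A(A)`. No finiteness hypothesis. [folklore] -/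
theorem natCard_range_mul_dvd (h : ∀ a, s (ψA a) = ψB (s a)) :
    Nat.card ψB.range * Nat.card ↥(s.ker ⊓ ψA.range) ∣ Nat.card ψA.range * Nat.card (B ⧸ s.range) := by
  set J : AddSubgroup B := (ψA.range).map s with hJ
  have hJle : J ≤ ψB.range := map_range_le_range s ψA ψB h
  -- `#ψ_B(B) = #(ψ_B(B)/J) · #J`
  have h1 : Nat.card ψB.range = Nat.card (↥ψB.range ⧸ J.addSubgroupOf ψB.range) * Nat.card J := by
    rw [AddSubgroup.card_eq_card_quotient_mul_card_addSubgroup (J.addSubgroupOf ψB.range),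
      Nat.card_congr (AddSubgroup.addSubgroupOfEquivOfLe hJle).toEquiv]
  -- the surjection `B/s(A) ↠ ψ_B(B)/J`
  set π : B →+ ↥ψB.range ⧸ J.addSubgroupOf ψB.range := (QuotientAddGroup.mk' _).comp ψB.rangeRestrict with hπ
  have hπker : s.range ≤ π.ker := by
    rintro _ ⟨a, rfl⟩
    rw [AddMonoidHom.mem_ker, hπ, AddMonoidHom.comp_apply, QuotientAddGroup.mk'_apply, QuotientAddGroup.eq_zero_iff,
      AddSubgroup.mem_addSubgroupOf, AddMonoidHom.coe_rangeRestrict, ← h a]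
    exact ⟨ψA a, ⟨a, rfl⟩, rfl⟩
  set q : B ⧸ s.range →+ ↥ψB.range ⧸ J.addSubgroupOf ψB.range := QuotientAddGroup.lift _ π hπker with hq
  have hqsurj : Function.Surjective q := by
    intro y
    induction y using QuotientAddGroup.induction_on with
    | H z =>
      obtain ⟨b, rfl⟩ := ψB.rangeRestrict_surjective z
      exact ⟨QuotientAddGroup.mk b, by rw [hq, QuotientAddGroup.lift_mk, hπ]; rfl⟩
  have h2 : Nat.card (↥ψB.range ⧸ J.addSubgroupOf ψB.range) ∣ Nat.card (B ⧸ s.range) := AddSubgroup.card_dvd_of_surjective q hqsurj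
  calc Nat.card ψB.range * Nat.card ↥(s.ker ⊓ ψA.range)
      = Nat.card (↥ψB.range ⧸ J.addSubgroupOf ψB.range) * (Nat.card J * Nat.card ↥(s.ker ⊓ ψA.range)) := by rw [h1, mul_assoc]
    _ = Nat.card (↥ψB.range ⧸ J.addSubgroupOf ψB.range) * Nat.card ψA.range := by rw [← natCard_range_eq_natCard_map_mul s ψA]
    _ ∣ Nat.card (B ⧸ s.range) * Nat.card ψA.range := mul_dvd_mul_right h2 _
    _ = Nat.card ψA.range * Nat.card (B ⧸ s.range) := mul_comm _ _

/-- ★★ Consequently, if `0 < #ψ_A(A) · #coker s` then **`0 < #ψ_B(B) ≤ #ψ_A(A) · #coker s`** (both images finite). [folklore] -/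
theorem natCard_range_pos_and_le (h : ∀ a, s (ψA a) = ψB (s a)) (hpos : 0 < Nat.card ψA.range * Nat.card (B ⧸ s.range)) :
    0 < Nat.card ψB.range ∧ Nat.card ψB.range ≤ Nat.card ψA.range * Nat.card (B ⧸ s.range) := by
  have hdvd := natCard_range_mul_dvd s ψA ψB h
  obtain ⟨hApos, -⟩ := CanonicallyOrderedAdd.mul_pos.mp hpos
  haveI : Finite ↥ψA.range := (Nat.card_pos_iff.mp hApos).2
  have hk : 0 < Nat.card ↥(s.ker ⊓ ψA.range) := by
    haveI : Finite ↥(s.ker ⊓ ψA.range) := Finite.of_injective _ (AddSubgroup.inclusion_injective (inf_le_right : s.ker ⊓ ψA.range ≤ ψA.range))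
    exact Nat.card_pos
  have hle := Nat.le_of_dvd hpos hdvd
  have hBpos : 0 < Nat.card ψB.range := by
    refine Nat.pos_of_ne_zero fun h0 ↦ ?_
    rw [h0, zero_mul] at hdvd
    exact (Nat.pos_iff_ne_zero.mp hpos) (Nat.eq_zero_of_zero_dvd hdvd)
  exact ⟨hBpos, (Nat.le_mul_of_pos_right _ hk).trans hle⟩

/-- Transport: the range of the co-restriction of `δ` to a `δ`-stable subgroup `K`, read back in the ambient group, is `δ(K)`. [folklore] -/
theorem map_subtype_range_codRestrict {X : Type*} [AddCommGroup X] (K : AddSubgroup X) (δ : X →+ X) (hK : ∀ c : ↥K, (δ.comp K.subtype) c ∈ K) :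
    ((δ.comp K.subtype).codRestrict K hK).range.map K.subtype = K.map δ := by
  have hcomp : K.subtype.comp ((δ.comp K.subtype).codRestrict K hK) = δ.comp K.subtype := by
    ext a
    rfl
  rw [← AddMonoidHom.range_comp, hcomp, AddMonoidHom.range_comp, AddSubgroup.range_subtype]

/-- Transport along an isomorphism `e : B₁ ≃ B` after `t : A → B₁`: same kernel. [folklore] -/
theorem ker_coe_comp_eq {B₁ : Type*} [AddCommGroup B₁] (e : B₁ ≃+ B) (t : A →+ B₁) : ((e : B₁ →+ B).comp t).ker = t.ker := by
  ext a
  rw [AddMonoidHom.mem_ker, AddMonoidHom.mem_ker, AddMonoidHom.comp_apply, AddMonoidHom.coe_coe, EmbeddingLike.map_eq_zero_iff]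

/-- Transport along an isomorphism `e : B₁ ≃ B` after `t : A → B₁`: cokernels of the same order. [folklore] -/
theorem natCard_quotient_range_coe_comp_eq {B₁ : Type*} [AddCommGroup B₁] (e : B₁ ≃+ B) (t : A →+ B₁) :
    Nat.card (B ⧸ ((e : B₁ →+ B).comp t).range) = Nat.card (B₁ ⧸ t.range) :=
  (Nat.card_congr (QuotientAddGroup.congr t.range ((e : B₁ →+ B).comp t).range e (AddMonoidHom.range_comp _ _).symm).toEquiv).symm

/-- Transport: for `K ≤ X` stable under `δ`, `ψ = δ|_K`, `s : K → B` whose kernel is cut out by `h : X → Y`, the subgroup `ker s ⊓ ψ(K)` of `K`, read back in `X`,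
is `ker h ⊓ δ(K)`. [folklore] -/
theorem map_subtype_ker_inf_range {X Y : Type*} [AddCommGroup X] [AddCommGroup Y] (K : AddSubgroup X) (ψ : ↥K →+ ↥K) (t : ↥K →+ B)
    (h : X →+ Y) (hth : ∀ a : ↥K, t a = 0 ↔ h a = 0) (δ : X →+ X) (hψ : ∀ a : ↥K, ((ψ a : ↥K) : X) = δ a)
    (hδK : ∀ c ∈ K, δ c ∈ K) : (t.ker ⊓ ψ.range).map K.subtype = h.ker ⊓ K.map δ := by
  ext x
  constructor
  · rintro ⟨a, ha, rfl⟩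
    obtain ⟨ha1, ⟨a₀, ha₀⟩⟩ := AddSubgroup.mem_inf.mp ha
    refine AddSubgroup.mem_inf.mpr ⟨?_, ⟨a₀, a₀.2, ?_⟩⟩
    · rw [AddMonoidHom.mem_ker, AddSubgroup.coe_subtype, ← hth]
      exact (AddMonoidHom.mem_ker).mp ha1
    · rw [AddSubgroup.coe_subtype, ← ha₀, hψ]
  · intro hx
    obtain ⟨hx1, ⟨c, hc, hcx⟩⟩ := AddSubgroup.mem_inf.mp hx
    have hxK : x ∈ K := by
      rw [← hcx]
      exact hδK c hc
    refine ⟨⟨x, hxK⟩, AddSubgroup.mem_inf.mpr ⟨?_, ⟨⟨c, hc⟩, Subtype.ext ?_⟩⟩, rfl⟩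
    · rw [AddMonoidHom.mem_ker, hth]
      exact (AddMonoidHom.mem_ker).mp hx1
    · rw [hψ]
      exact hcx

end Abstract

/-! ## §2 Selmer: the image of `γ^{pⁿ} − 1` on `Sel_{p^∞}(E/K_{n+1})` versus the growth number -/

section Selmer

variable {K : Type u} [Field K] [NumberField K] (W : WeierstrassCurve K) {p : ℕ} [hp : Fact p.Prime] (κ : ZpExtension K p)
  {γ : Field.absoluteGaloisGroup K}

/-- `Sel_{p^∞}(E/K_m)` is stable under `conj_g − 1` for every `g ∈ Γ_K` (tree `map_conjH1_selmerGroupOver_le_holds`). [cite: GreenbergLNM1716, §1 (after Conj. 1.3)] -/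
theorem conjH1_sub_id_mem_selmerLayer (m : ℕ) (g : Field.absoluteGaloisGroup K) {c : W.subgroupH1 p (κ.layerSubgroup m)}
    (hc : c ∈ W.selmerLayer κ m) :
    (W.conjH1 p (κ.layerSubgroup m) g - AddMonoidHom.id (W.subgroupH1 p (κ.layerSubgroup m))) c ∈ W.selmerLayer κ m := by
  rw [AddMonoidHom.sub_apply, AddMonoidHom.id_apply]
  exact sub_mem (W.map_conjH1_selmerGroupOver_le_holds p (κ.layerSubgroup m) g ⟨c, hc, rfl⟩) hc

omit [NumberField K] in
/-- Restriction `H¹(K_m, E[p^∞]) → H¹(K_∞, E[p^∞])` commutes with conjugation (tree `resOfLe_comp_conjH1_holds`). [cite: NeukirchSchmidtWingberg2008, I.§5] -/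
theorem layerToInfty_conjH1 (m : ℕ) (g : Field.absoluteGaloisGroup K) (c : W.subgroupH1 p (κ.layerSubgroup m)) :
    W.layerToInfty κ m (W.conjH1 p (κ.layerSubgroup m) g c) = W.conjH1 p κ.kerSubgroup g (W.layerToInfty κ m c) :=
  congrArg (fun f ↦ f c) (resOfLe_comp_conjH1_holds (M := geomPrimaryTorsion W p) (κ.kerSubgroup_le_layerSubgroup m) g)

/-- ★★ **THE FINITE-LEVEL IMAGE COMPUTES THE GROWTH NUMBER UP TO THE CONTROL KERNEL AND COKERNEL.** For every number field `K`, every `ℤ_p`-extension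
`κ` with topological generator `γ`, every `n`, with `g = γ^{pⁿ}`, `Sel_{n+1} = Sel_{p^∞}(E/K_{n+1})`, `h_{n+1} : H¹(K_{n+1}, E[p^∞]) → H¹(K_∞, E[p^∞])`,
`s_{n+1} = h_{n+1}|Sel_{n+1} : Sel_{n+1} → Sel_∞^{Γ_{n+1}}`, `I_{n+1} = (conj_g − 1)·Sel_{n+1}` and `I_∞ = (conj_γ^{pⁿ} − 1)·Sel_∞^{Γ_{n+1}}` (whose order is the
growth number `g_n = #(ω_nX/ω_{n+1}X)`, file VI): **`#I_∞ · #(ker h_{n+1} ⊓ I_{n+1}) ∣ #I_{n+1} · #coker s_{n+1}`** and **`#I_{n+1} ∣ #I_∞ · #ker s_{n+1}`**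
(`Nat.card`; no hypothesis). [cite: GreenbergLNM1716, §3 pp. 85–86 and §4 Lemma 4.3] [cite: Mazur1972, §6] -/
theorem natCard_map_endInvariants_mul_dvd_and_dvd (hγ : κ.IsTopGenerator γ) (n : ℕ) :
    (Nat.card ↥((endInvariants ((W.conjSelmerInfty κ γ) ^ (p ^ (n + 1)) - 1)).map
          (AddMonoidHomClass.toAddMonoidHom ((W.conjSelmerInfty κ γ) ^ (p ^ n) - 1))) *
        Nat.card ↥((W.layerToInfty κ (n + 1)).ker ⊓ (W.selmerLayer κ (n + 1)).map
          (W.conjH1 p (κ.layerSubgroup (n + 1)) (γ ^ p ^ n) - AddMonoidHom.id (W.subgroupH1 p (κ.layerSubgroup (n + 1))))) ∣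
      Nat.card ↥((W.selmerLayer κ (n + 1)).map
          (W.conjH1 p (κ.layerSubgroup (n + 1)) (γ ^ p ^ n) - AddMonoidHom.id (W.subgroupH1 p (κ.layerSubgroup (n + 1))))) *
        Nat.card (W.CokerS κ (n + 1))) ∧
    (Nat.card ↥((W.selmerLayer κ (n + 1)).map
          (W.conjH1 p (κ.layerSubgroup (n + 1)) (γ ^ p ^ n) - AddMonoidHom.id (W.subgroupH1 p (κ.layerSubgroup (n + 1))))) ∣
      Nat.card ↥((endInvariants ((W.conjSelmerInfty κ γ) ^ (p ^ (n + 1)) - 1)).map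
          (AddMonoidHomClass.toAddMonoidHom ((W.conjSelmerInfty κ γ) ^ (p ^ n) - 1))) *
        Nat.card ↥((W.layerToInfty κ (n + 1)).ker ⊓ W.selmerLayer κ (n + 1))) := by
  set φ : AddMonoid.End (W.selmerInfty κ) := W.conjSelmerInfty κ γ with hφ
  set Sel : AddSubgroup (W.subgroupH1 p (κ.layerSubgroup (n + 1))) := W.selmerLayer κ (n + 1) with hSel
  set δ : W.subgroupH1 p (κ.layerSubgroup (n + 1)) →+ W.subgroupH1 p (κ.layerSubgroup (n + 1)) :=
    W.conjH1 p (κ.layerSubgroup (n + 1)) (γ ^ p ^ n) - AddMonoidHom.id (W.subgroupH1 p (κ.layerSubgroup (n + 1))) with hδ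
  set η : AddMonoid.End (W.selmerInfty κ) := φ ^ (p ^ n) - 1 with hη
  set Binv : AddSubgroup (W.selmerInfty κ) := endInvariants (φ ^ (p ^ (n + 1)) - 1) with hBinv
  obtain ⟨e, he⟩ := exists_addEquiv_selmerInvariants_endInvariants W κ hγ (n + 1)
  -- the endomorphism downstairs
  have hδmem : ∀ c : ↥Sel, (δ.comp Sel.subtype) c ∈ Sel := fun c ↦ conjH1_sub_id_mem_selmerLayer W κ (n + 1) (γ ^ p ^ n) c.2
  set ψA : ↥Sel →+ ↥Sel := (δ.comp Sel.subtype).codRestrict Sel hδmem with hψA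
  have hψA_coe : ∀ a : ↥Sel, ((ψA a : ↥Sel) : W.subgroupH1 p (κ.layerSubgroup (n + 1))) = δ a := fun _ ↦ rfl
  -- the endomorphism upstairs
  have hcomm : Commute (φ ^ (p ^ (n + 1)) - 1) η :=
    ((Commute.pow_pow_self φ _ _).sub_left (Commute.one_left _)).sub_right (Commute.one_right _)
  have hηmem : ∀ b : ↥Binv, ((AddMonoidHomClass.toAddMonoidHom η).comp Binv.subtype) b ∈ Binv := by
    intro b
    have hb : (φ ^ (p ^ (n + 1)) - 1) (b : W.selmerInfty κ) = 0 := (mem_endInvariants_iff _ _).mp b.2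
    show η (b : W.selmerInfty κ) ∈ endInvariants (φ ^ (p ^ (n + 1)) - 1)
    rw [mem_endInvariants_iff]
    change ((φ ^ (p ^ (n + 1)) - 1) * η) (b : W.selmerInfty κ) = 0
    rw [hcomm.eq, AddMonoid.End.coe_mul, Function.comp_apply, hb, map_zero]
  set ψB : ↥Binv →+ ↥Binv := ((AddMonoidHomClass.toAddMonoidHom η).comp Binv.subtype).codRestrict Binv hηmem with hψB
  have hψB_coe : ∀ b : ↥Binv, ((ψB b : ↥Binv) : W.selmerInfty κ) = η (b : W.selmerInfty κ) := fun _ ↦ rfl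
  -- the control map `s = e ∘ s_{n+1}`
  set s : ↥Sel →+ ↥Binv := (e : _ →+ ↥Binv).comp (W.sMap κ (n + 1)) with hs_def
  have hs_apply : ∀ a : ↥Sel, s a = e (W.sMap κ (n + 1) a) := fun _ ↦ rfl
  have hs_coe : ∀ a : ↥Sel, (((s a : ↥Binv) : W.selmerInfty κ) : W.subgroupH1 p κ.kerSubgroup) = W.layerToInfty κ (n + 1) a := by
    intro a
    rw [hs_apply, he, coe_sMap_apply]
  -- equivariance `s ∘ ψ_A = ψ_B ∘ s`
  have hs : ∀ a, s (ψA a) = ψB (s a) := by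
    intro a
    apply Subtype.ext
    apply Subtype.ext
    rw [hs_coe, hψA_coe, hψB_coe, hδ, AddMonoidHom.sub_apply, AddMonoidHom.id_apply, map_sub, layerToInfty_conjH1, hη,
      End_sub_apply, AddMonoid.End.one_apply, AddSubgroupClass.coe_sub, coe_conjSelmerInfty_pow_apply, hs_coe]
  -- transport of the five cardinalities
  have c1 : Nat.card ψB.range = Nat.card ↥(Binv.map (AddMonoidHomClass.toAddMonoidHom η)) := by
    rw [← AddSubgroup.card_subtype Binv ψB.range, map_subtype_range_codRestrict]
  have c2 : Nat.card ψA.range = Nat.card ↥(Sel.map δ) := by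
    rw [← AddSubgroup.card_subtype Sel ψA.range, map_subtype_range_codRestrict]
  have c3 : Nat.card s.ker = Nat.card ↥((W.layerToInfty κ (n + 1)).ker ⊓ Sel) := by
    rw [hs_def, ker_coe_comp_eq, W.natCard_ker_sMap κ (n + 1)]
  have c4 : Nat.card (↥Binv ⧸ s.range) = Nat.card (W.CokerS κ (n + 1)) := by
    rw [hs_def, natCard_quotient_range_coe_comp_eq, W.range_sMap_eq κ (n + 1)]
  have hsh : ∀ a : ↥Sel, s a = 0 ↔ W.layerToInfty κ (n + 1) a = 0 := by
    intro a
    rw [← hs_coe a]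
    exact ⟨fun h0 ↦ by rw [h0]; rfl, fun h0 ↦ Subtype.ext (Subtype.ext h0)⟩
  have c5 : Nat.card ↥(s.ker ⊓ ψA.range) = Nat.card ↥((W.layerToInfty κ (n + 1)).ker ⊓ Sel.map δ) := by
    rw [← AddSubgroup.card_subtype Sel (s.ker ⊓ ψA.range), map_subtype_ker_inf_range Sel ψA s (W.layerToInfty κ (n + 1)) hsh δ hψA_coe
      (fun c hc ↦ conjH1_sub_id_mem_selmerLayer W κ (n + 1) (γ ^ p ^ n) hc)]
  refine ⟨?_, ?_⟩
  · have h := natCard_range_mul_dvd s ψA ψB hs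
    rwa [c1, c5, c2, c4] at h
  · have h := natCard_range_dvd_mul_natCard_ker s ψA ψB hs
    rwa [c1, c2, c3] at h

/-- ★★ **`g_n · #(ker h_{n+1} ⊓ I_{n+1}) ∣ #I_{n+1} · #coker s_{n+1}`** and **`#I_{n+1} ∣ g_n · #ker s_{n+1}`**, `g_n = #(ω_nX/ω_{n+1}X)` the growth number of the Iwasawa module
`X = X(E/K_∞)` of ANY Pontryagin-dual datum, `I_{n+1} = (conj_{γ^{pⁿ}} − 1)·Sel_{p^∞}(E/K_{n+1})`: the finite-level image and the growth number differ by factors dividing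
the orders of the control kernel `ker s_{n+1} = ker h_{n+1} ∩ Sel_{n+1}` and cokernel `coker s_{n+1}` (file VI's `g_n = #((conj_γ^{pⁿ} − 1)·Sel_∞^{Γ_{n+1}})` and the theorem above).
[cite: GreenbergLNM1716, §1 pp. 60–65, §3 pp. 85–86] [cite: Washington1997, §13.3 Lemma 13.18] -/
theorem natCard_growth_mul_dvd_and_dvd (hγ : κ.IsTopGenerator γ) (D : W.SelmerDualData κ γ) (n : ℕ) :
    (Nat.card (↥(Ideal.span {((1 + PowerSeries.X : PowerSeries ℤ_[p]) ^ (p ^ n) - 1 : IwasawaAlgebra p)} • ⊤ : Submodule (IwasawaAlgebra p) D.X) ⧸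
          (Ideal.span {(((Polynomial.cyclotomic (p ^ (n + 1)) ℤ_[p]).comp (Polynomial.X + 1) : ℤ_[p][X]) : IwasawaAlgebra p)} • ⊤ :
            Submodule (IwasawaAlgebra p) ↥(Ideal.span {((1 + PowerSeries.X : PowerSeries ℤ_[p]) ^ (p ^ n) - 1 : IwasawaAlgebra p)} • ⊤ :
              Submodule (IwasawaAlgebra p) D.X))) *
        Nat.card ↥((W.layerToInfty κ (n + 1)).ker ⊓ (W.selmerLayer κ (n + 1)).map
          (W.conjH1 p (κ.layerSubgroup (n + 1)) (γ ^ p ^ n) - AddMonoidHom.id (W.subgroupH1 p (κ.layerSubgroup (n + 1))))) ∣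
      Nat.card ↥((W.selmerLayer κ (n + 1)).map
          (W.conjH1 p (κ.layerSubgroup (n + 1)) (γ ^ p ^ n) - AddMonoidHom.id (W.subgroupH1 p (κ.layerSubgroup (n + 1))))) *
        Nat.card (W.CokerS κ (n + 1))) ∧
    (Nat.card ↥((W.selmerLayer κ (n + 1)).map
          (W.conjH1 p (κ.layerSubgroup (n + 1)) (γ ^ p ^ n) - AddMonoidHom.id (W.subgroupH1 p (κ.layerSubgroup (n + 1))))) ∣
      Nat.card (↥(Ideal.span {((1 + PowerSeries.X : PowerSeries ℤ_[p]) ^ (p ^ n) - 1 : IwasawaAlgebra p)} • ⊤ : Submodule (IwasawaAlgebra p) D.X) ⧸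
          (Ideal.span {(((Polynomial.cyclotomic (p ^ (n + 1)) ℤ_[p]).comp (Polynomial.X + 1) : ℤ_[p][X]) : IwasawaAlgebra p)} • ⊤ :
            Submodule (IwasawaAlgebra p) ↥(Ideal.span {((1 + PowerSeries.X : PowerSeries ℤ_[p]) ^ (p ^ n) - 1 : IwasawaAlgebra p)} • ⊤ :
              Submodule (IwasawaAlgebra p) D.X))) *
        Nat.card ↥((W.layerToInfty κ (n + 1)).ker ⊓ W.selmerLayer κ (n + 1))) := by
  rw [natCard_growth_eq_natCard_map W κ hγ D n]
  exact natCard_map_endInvariants_mul_dvd_and_dvd W κ hγ n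

/-! ## §3 The certificate: `μ = 0` from ONE small finite-level image, any rank -/

/-- ★★★ **`μ = 0` FROM ONE SMALL FINITE-LEVEL IMAGE (cokernel form), ANY RANK.** `E/K`, `κ` any `ℤ_p`-extension with topological generator `γ`, `D` any Pontryagin-dual
datum with `X` finitely generated torsion, `n` any layer, `g = γ^{pⁿ}` (a generator of `Gal(K_{n+1}/K_n)`), `I_{n+1} = (conj_g − 1)·Sel_{p^∞}(E/K_{n+1}) ⊆ H¹(K_{n+1}, E[p^∞])`.
If **`0 < #I_{n+1} · #coker s_{n+1} < p^{pⁿ(p−1)}`** then **`μ(X(E/K_∞)) = 0`**: by §2, `0 < #((conj_γ^{pⁿ} − 1)·Sel_∞^{Γ_{n+1}}) ≤ #I_{n+1} · #coker s_{n+1}`, and file VI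
concludes. Usable in towers of positive rank (only the image of `g − 1`, not `Sel_{n+1}`, has to be finite). [cite: GreenbergLNM1716, Conj. 1.11, §3 pp. 85–86, §4 Lemma 4.3]
[cite: Washington1997, §13.3 Thm. 13.13] -/
theorem mu_eq_zero_of_natCard_map_selmerLayer_mul_cokerS_lt (hγ : κ.IsTopGenerator γ) (D : W.SelmerDualData κ γ) [Module.Finite (IwasawaAlgebra p) D.X]
    (hD : D.IsTorsion) {n : ℕ}
    (hpos : 0 < Nat.card ↥((W.selmerLayer κ (n + 1)).map
        (W.conjH1 p (κ.layerSubgroup (n + 1)) (γ ^ p ^ n) - AddMonoidHom.id (W.subgroupH1 p (κ.layerSubgroup (n + 1))))) *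
      Nat.card (W.CokerS κ (n + 1)))
    (hlt : Nat.card ↥((W.selmerLayer κ (n + 1)).map
        (W.conjH1 p (κ.layerSubgroup (n + 1)) (γ ^ p ^ n) - AddMonoidHom.id (W.subgroupH1 p (κ.layerSubgroup (n + 1))))) *
      Nat.card (W.CokerS κ (n + 1)) < p ^ (p ^ n * (p - 1))) : D.mu = 0 := by
  obtain ⟨hdvd, -⟩ := natCard_map_endInvariants_mul_dvd_and_dvd W κ hγ n
  set a := Nat.card ↥((endInvariants ((W.conjSelmerInfty κ γ) ^ (p ^ (n + 1)) - 1)).map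
    (AddMonoidHomClass.toAddMonoidHom ((W.conjSelmerInfty κ γ) ^ (p ^ n) - 1))) with ha
  set I := (W.selmerLayer κ (n + 1)).map
    (W.conjH1 p (κ.layerSubgroup (n + 1)) (γ ^ p ^ n) - AddMonoidHom.id (W.subgroupH1 p (κ.layerSubgroup (n + 1)))) with hI
  set k := Nat.card ↥((W.layerToInfty κ (n + 1)).ker ⊓ I) with hk
  obtain ⟨hIpos, -⟩ := CanonicallyOrderedAdd.mul_pos.mp hpos
  haveI : Finite ↥I := (Nat.card_pos_iff.mp hIpos).2
  have hkpos : 0 < k := by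
    haveI : Finite ↥((W.layerToInfty κ (n + 1)).ker ⊓ I) :=
      Finite.of_injective _ (AddSubgroup.inclusion_injective (inf_le_right : (W.layerToInfty κ (n + 1)).ker ⊓ I ≤ I))
    exact Nat.card_pos
  have hapos : 0 < a := by
    refine Nat.pos_of_ne_zero fun h0 ↦ ?_
    rw [h0, zero_mul] at hdvd
    exact (Nat.pos_iff_ne_zero.mp hpos) (Nat.eq_zero_of_zero_dvd hdvd)
  have hale : a < p ^ (p ^ n * (p - 1)) := ((Nat.le_mul_of_pos_right _ hkpos).trans (Nat.le_of_dvd hpos hdvd)).trans_lt hlt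
  exact mu_eq_zero_of_natCard_map_endInvariants_pos_lt W κ hγ D hD hapos hale

/-- ★★★ **`μ = 0` FROM ONE SMALL FINITE-LEVEL IMAGE (Greenberg's `ker g` form), ANY RANK.** Same setting, with Greenberg's control kernel `ker g_{n+1} = A_{n+1}/Sel_{n+1}`
(tree `KerG`, onto `coker s_{n+1}` by `coker h_{n+1} = 0`): if **`0 < #((conj_{γ^{pⁿ}} − 1)·Sel_{p^∞}(E/K_{n+1})) · #ker g_{n+1} < p^{pⁿ(p−1)}`** at SOME `n`, then
**`μ(X(E/K_∞)) = 0`**. [cite: GreenbergLNM1716, Conj. 1.11, §3 Lemmas 3.1–3.3, §4 Lemma 4.3] [cite: Mazur1972, §6] -/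
theorem mu_eq_zero_of_natCard_map_selmerLayer_mul_kerG_lt (hγ : κ.IsTopGenerator γ) (D : W.SelmerDualData κ γ) [Module.Finite (IwasawaAlgebra p) D.X]
    (hD : D.IsTorsion) {n : ℕ}
    (hpos : 0 < Nat.card ↥((W.selmerLayer κ (n + 1)).map
        (W.conjH1 p (κ.layerSubgroup (n + 1)) (γ ^ p ^ n) - AddMonoidHom.id (W.subgroupH1 p (κ.layerSubgroup (n + 1))))) *
      Nat.card (W.KerG κ (n + 1)))
    (hlt : Nat.card ↥((W.selmerLayer κ (n + 1)).map
        (W.conjH1 p (κ.layerSubgroup (n + 1)) (γ ^ p ^ n) - AddMonoidHom.id (W.subgroupH1 p (κ.layerSubgroup (n + 1))))) *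
      Nat.card (W.KerG κ (n + 1)) < p ^ (p ^ n * (p - 1))) : D.mu = 0 := by
  obtain ⟨hIpos, hGpos⟩ := CanonicallyOrderedAdd.mul_pos.mp hpos
  haveI : Finite (W.KerG κ (n + 1)) := (Nat.card_pos_iff.mp hGpos).2
  have hdvd : Nat.card (W.CokerS κ (n + 1)) ∣ Nat.card (W.KerG κ (n + 1)) :=
    AddSubgroup.card_dvd_of_surjective (W.kerGToCoker κ (n + 1)) (W.kerGToCoker_surjective κ (n + 1))
  haveI : Finite (W.CokerS κ (n + 1)) := Finite.of_surjective _ (W.kerGToCoker_surjective κ (n + 1))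
  have hCpos : 0 < Nat.card (W.CokerS κ (n + 1)) := Nat.card_pos
  exact mu_eq_zero_of_natCard_map_selmerLayer_mul_cokerS_lt W κ hγ D hD (Nat.mul_pos hIpos hCpos)
    ((Nat.mul_le_mul_left _ (Nat.le_of_dvd hGpos hdvd)).trans_lt hlt)

/-- ★★ **`p^{pⁿ(p−1)·μ} ∣ #I_{n+1} · #coker s_{n+1}` whenever `ker h_{n+1} ⊓ I_{n+1}` is trivial-or-counted**: precisely `p^{pⁿ(p−1)·μ(X)} · #(ker h_{n+1} ⊓ I_{n+1}) ∣ #I_{n+1} · #coker s_{n+1}`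
for EVERY dual datum with `X` f.g. torsion (`μ ≥ 1` ⟹ the finite-level image times the control cokernel is divisible by `p^{pⁿ(p−1)}` at EVERY layer).
[cite: GreenbergLNM1716, Thm. 1.10 and Conj. 1.11] [cite: Washington1997, §13.3 Thm. 13.13] -/
theorem pow_mul_dvd_natCard_map_selmerLayer_mul_cokerS (hγ : κ.IsTopGenerator γ) (D : W.SelmerDualData κ γ) [Module.Finite (IwasawaAlgebra p) D.X]
    (hD : D.IsTorsion) (n : ℕ) :
    p ^ (p ^ n * (p - 1) * D.mu) * Nat.card ↥((W.layerToInfty κ (n + 1)).ker ⊓ (W.selmerLayer κ (n + 1)).map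
          (W.conjH1 p (κ.layerSubgroup (n + 1)) (γ ^ p ^ n) - AddMonoidHom.id (W.subgroupH1 p (κ.layerSubgroup (n + 1))))) ∣
      Nat.card ↥((W.selmerLayer κ (n + 1)).map
          (W.conjH1 p (κ.layerSubgroup (n + 1)) (γ ^ p ^ n) - AddMonoidHom.id (W.subgroupH1 p (κ.layerSubgroup (n + 1))))) *
        Nat.card (W.CokerS κ (n + 1)) := by
  obtain ⟨hdvd, -⟩ := natCard_map_endInvariants_mul_dvd_and_dvd W κ hγ n
  exact (mul_dvd_mul_right (pow_dvd_natCard_map_endInvariants W κ hγ D hD n) _).trans hdvd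

end Selmer

end Summit.BirchSwinnertonDyer.BirchSwinnertonDyer.Theorems.AlignedTransportAtTwoHalfDescentLayerIndexGrowthFinite

end
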